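import Summits.BirchSwinnertonDyer.BirchSwinnertonDyer.Theorems.ManinLocalTwoThreeThreeBlindVeluAscent
import HarnessLib

/-!
# The ascent criterion at `3` for rational `3`-torsion kernels is EXACTLY the `z⁹` congruence:
# `u(W → W/⟨T⟩) = 3 ⟺ Y₁ ≡ 4(α/3)³ (mod 9)` (the converse of (VÉLU₃♯), PROVED)

Summit `BirchSwinnertonDyer`, route `ManinLocalTwoThree` (cell bsd-f2-manin), crux C3 `ManinPrimeToThreeAtNine`
(stmt-BirchSwinnertonDyer-22968), line `kato_shift_three`, stub NB₃^V `NoAscendingThreeTorsionOptimal` (typer p646277).  Sequel of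
`Theorems/ManinLocalTwoThreeThreeBlindVeluAscent.lean` (p645684: congruence ⟹ ascent).  Here the CONVERSE: for a globally
minimal `W/ℚ` with `3`-integral `E♮ = E_{W,1}` and a rational point `T = (X₁, Y₁)` of order `3` on `E♮`, if some globally
minimal `W'` carries `(3⁻⁴A, 3⁻⁶B)` (`(A, B)` the `u = 1` Vélu pair of `T`), then `ν := (Y₁ − 4(α/3)³)/9 ∈ ℤ₃`.

Proof (`3`-adic bookkeeping on the lead's uniform descaled model `M″ = [2s, −4s², 0, −6sν, −3ν²]`, `s = α/3`):
* `c₆(W') = c₆(M″) = 1728s⁶ + 5184s³ν + 2592ν²`, `c₄(W') = 144s⁴ + 288sν` and `Δ(W') = −432·Y₁·ν³` (ring identities modulo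
  the flex relation `α² = 3X₁`);
* `W` is `3`-minimal, so `27 ∤ Y₁` in `ℤ₃` (§1: otherwise `[2s, 0, 2Y₁/27, 0, 0]` is a `3`-integral model of `W` of
  discriminant `3⁻¹²Δ_min(W)`);
* `W'` is INTEGRAL (`integralModelInt`): `Δ(W') ∈ ℤ` and — Kraus's necessary condition at `3` — `9 ∣ c₆(W') ⟹ 27 ∣ c₆(W')`
  (§2, from `c₆ = −b₂³ + 36b₂b₄ − 216b₆`);
* if `‖ν‖₃ ≥ 9` then `‖Δ(W')‖₃ = 3⁻³‖Y₁‖‖ν‖³ > 1`; if `‖ν‖₃ = 3` then `‖c₆(W')‖₃ = ‖2592ν²‖₃ = 3⁻²` exactly (the other two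
  terms have norm `≤ 3⁻³`), i.e. `9 ∥ c₆(W')` — both absurd (§3).

So, with p645684: **`∃ W'` globally minimal carrying `(3⁻⁴A, 3⁻⁶B)` ⟺ `‖ν‖₃ ≤ 1`**
(`exists_isGloballyMinimal_three_velu_three_iff_congruence`), the lead's chart law of HOME/p1/BL-scan-memo-p1-g5.md
(«λ(T) = 3 ⟺ [v₃α = 1 ∧ Y₁ ≡ 4(α/3)³ (9)] ∨ [v₃α ≥ 2 ∧ v₃Y₁ = 2]», 62 522 / 62 522) as a THEOREM in both directions; and
the stub NB₃^V is EQUIVALENT to the elementary, `W'`-free law NB₃^{cong} «no `X₀(N)`-optimal `W` with `9 ∣ N` has a rational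
`3`-torsion point `T = (X₁, Y₁)` on `E♮` with `Y₁ ≡ 4(α/3)³ (mod 9)`»
(`noAscendingThreeTorsionOptimal_iff_noCongruentThreeTorsionOptimal`) — the form the census engines test.

HONEST FRAMING: local / model-theoretic theorems; C3, Manin's conjecture and BSD are NOT proved; NB₃^V stays OPEN.
No definitions, no named facts, no sorry.

References: [SilvermanAEC2009] III.1 Table 3.1, VII.1; A. Kraus, *Quelques remarques à propos des invariants c₄, c₆ et Δ d'une
courbe elliptique*, Acta Arith. 54 (1989) 75–80 (only the trivial necessity direction at `3` is used and proved here);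
[DokchitserDokchitser2015LocalInvariants] Table 1; J. Vélu, C. R. Acad. Sci. Paris 273 (1971).
-/

set_option linter.dupNamespace false
set_option autoImplicit false

noncomputable section

open scoped Classical

open WeierstrassCurve IsDedekindDomain NumberField Rat.HeightOneSpectrum Polynomial
  Literature.NumberTheory.DiophantineGeometry Literature.NumberTheory.EllipticCurves
  Literature.NumberTheory.EllipticCurves.ModularForms
  Summit.BirchSwinnertonDyer.Rank1Residual.ManinAdditive
  Summit.BirchSwinnertonDyer.Rank1Residual.ManinAdditive.CuspidalKummer
  Summit.BirchSwinnertonDyer.Rank1Residual.ManinAdditive.CuspidalKummerThree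

namespace Summit.BirchSwinnertonDyer.BirchSwinnertonDyer.Theorems.ManinLocalTwoThree

/-! ### §0. `3`-adic helpers -/

/-- In `ℚ₃`: `‖x‖ < 9 ⟹ ‖x‖ ≤ 3` (the value group is `3^ℤ`). [folklore] -/
theorem norm_le_three_of_norm_lt_nine_padicThree {x : ℚ_[3]} (hx : ‖x‖ < 9) : ‖x‖ ≤ 3 := by
  by_cases hx0 : x = 0
  · rw [hx0, norm_zero]; norm_num
  have hn : ‖x‖ = (3 : ℝ) ^ (-x.valuation) := by exact_mod_cast Padic.norm_eq_zpow_neg_valuation hx0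
  rw [hn] at hx ⊢
  have hv : -x.valuation ≤ (1 : ℤ) := by
    by_contra hlt
    have h' : (3 : ℝ) ^ (2 : ℤ) ≤ (3 : ℝ) ^ (-x.valuation) := zpow_le_zpow_right₀ (by norm_num) (by omega)
    have h9 : (3 : ℝ) ^ (2 : ℤ) = 9 := by norm_num
    rw [h9] at h'
    linarith
  have h' : (3 : ℝ) ^ (-x.valuation) ≤ (3 : ℝ) ^ (1 : ℤ) := zpow_le_zpow_right₀ (by norm_num) hv
  rwa [zpow_one] at h'

/-- `‖(n : ℚ₃)‖ = 1` for `n` prime to `3`. [folklore] -/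
theorem norm_natCast_padicThree_eq_one {n : ℕ} (hn : Nat.Coprime 3 n) : ‖(n : ℚ_[3])‖ = 1 :=
  Padic.norm_natCast_eq_one_iff.mpr hn

/-- `‖(3ᵏ : ℚ₃)‖ = 1/3ᵏ`. [folklore] -/
theorem norm_three_pow_padicThree (k : ℕ) : ‖((3 : ℚ_[3]) ^ k)‖ = 1 / (3 : ℝ) ^ k := by
  have := Padic.norm_p_pow (p := 3) k
  rw [zpow_neg, zpow_natCast, ← one_div] at this
  exact_mod_cast this

/-- `‖27‖₃ = 1/27`. [folklore] -/
theorem norm_twentyseven_padicThree : ‖(27 : ℚ_[3])‖ = 1 / 27 := by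
  rw [show (27 : ℚ_[3]) = 3 ^ 3 by norm_num, norm_three_pow_padicThree]; norm_num

/-- `‖81‖₃ = 1/81`. [folklore] -/
theorem norm_eightyone_padicThree : ‖(81 : ℚ_[3])‖ = 1 / 81 := by
  rw [show (81 : ℚ_[3]) = 3 ^ 4 by norm_num, norm_three_pow_padicThree]; norm_num

/-! ### §1. A `3`-minimal `W` has `27 ∤ Y₁` -/

/-- **On a globally minimal `W` with `3`-integral `E♮`, a rational point `T = (X₁, Y₁)` of order `3` on `E♮` has
`‖Y₁/27‖₃ > 1`**: otherwise the `3`-torsion chart `[2α, 0, 2Y₁, 0, 0]` of `W` descends by `u = 3` to the `3`-integral model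
`[2(α/3), 0, 2(Y₁/27), 0, 0]` of discriminant `3⁻¹²Δ_min(W)`. [cite: SilvermanAEC2009, III.1 Table 3.1 and VII.1] -/
theorem one_lt_norm_div_twentyseven_of_isShortThreeTorsion (W : WeierstrassCurve ℚ) [W.IsElliptic] [W.IsGloballyMinimal]
    (hA : ‖(((shortModel W 1).a₄ : ℚ) : ℚ_[3])‖ ≤ 1) (hB : ‖(((shortModel W 1).a₆ : ℚ) : ℚ_[3])‖ ≤ 1)
    {X₁ Y₁ : ℚ} (hT : IsShortThreeTorsion W 1 X₁ Y₁) : 1 < ‖((Y₁ / 27 : ℚ) : ℚ_[3])‖ := by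
  by_contra hle
  rw [not_lt] at hle
  obtain ⟨hX, -⟩ := norm_le_one_of_isShortThreeTorsion W hA hB hT
  have hs := norm_tangentSlope_div_three_le_one hT hX
  have hflex := tangentSlope_sq_eq_three_mul hT
  obtain ⟨hc4, hc6⟩ := c₄_c₆_eq_of_isShortThreeTorsion W hT
  set α := tangentSlope W 1 X₁ Y₁ with hαdef
  obtain ⟨M, hM⟩ : ∃ M : WeierstrassCurve ℚ, M = ⟨2 * (α / 3), 0, 2 * (Y₁ / 27), 0, 0⟩ := ⟨_, rfl⟩
  have h81 : (3 : ℚ) ^ 4 * M.c₄ = W.c₄ := by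
    rw [hc4, hM]
    simp only [WeierstrassCurve.c₄, WeierstrassCurve.b₂, WeierstrassCurve.b₄]
    linear_combination (16 * α ^ 2 + 48 * X₁) * hflex
  have h729 : (3 : ℚ) ^ 6 * M.c₆ = W.c₆ := by
    rw [hc6, hM]
    simp only [WeierstrassCurve.c₆, WeierstrassCurve.b₂, WeierstrassCurve.b₄, WeierstrassCurve.b₆]
    linear_combination (-64 * α ^ 4 - 192 * X₁ * α ^ 2 - 576 * X₁ ^ 2 + 576 * Y₁ * α) * hflex
  have hM4 : M.c₄ = (3 ^ 4)⁻¹ * W.c₄ := by rw [← h81]; ring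
  have hM6 : M.c₆ = (3 ^ 6)⁻¹ * W.c₆ := by rw [← h729]; ring
  obtain ⟨C, hC⟩ := exists_variableChange_of_c₄_eq_of_c₆_eq (W₁ := W) (W₂ := M) (w := 3) three_ne_zero hM4 hM6
  haveI : Fact (Nat.Prime 3) := ⟨Nat.prime_three⟩
  have hn2 : ‖(2 : ℚ_[3])‖ ≤ 1 := by have := Padic.norm_int_le_one (p := 3) 2; exact_mod_cast this
  have hle' := padicValInt_minimalDiscriminantInt_le_padicValRat_Δ_smul_of_norm_le_one W C 3
    (by
      rw [hC, hM]
      have e : ((2 * (α / 3) : ℚ) : ℚ_[3]) = 2 * ((α / 3 : ℚ) : ℚ_[3]) := by push_cast; ring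
      rw [e, norm_mul]
      exact mul_le_one₀ hn2 (norm_nonneg _) hs)
    (by rw [hC, hM]; simp)
    (by
      rw [hC, hM]
      have e : ((2 * (Y₁ / 27) : ℚ) : ℚ_[3]) = 2 * ((Y₁ / 27 : ℚ) : ℚ_[3]) := by push_cast; ring
      rw [e, norm_mul]
      exact mul_le_one₀ hn2 (norm_nonneg _) hle)
    (by rw [hC, hM]; simp) (by rw [hC, hM]; simp)
  have hΔM : (C • W).Δ = (3 : ℚ)⁻¹ ^ 12 * (W.minimalDiscriminantInt : ℚ) := by
    rw [hC, cast_minimalDiscriminantInt]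
    have h1 := M.c_relation
    have h2 := W.c_relation
    rw [hM4, hM6] at h1
    linear_combination h1 / 1728 - h2 / (1728 * 3 ^ 12)
  have hm0 : (W.minimalDiscriminantInt : ℚ) ≠ 0 := by exact_mod_cast minimalDiscriminantInt_ne_zero W
  rw [hΔM, padicValRat.mul (pow_ne_zero _ (inv_ne_zero three_ne_zero)) hm0, padicValRat.pow,
    padicValRat.inv, padicValRat.of_int] at hle'
  have h3v : padicValRat 3 (3 : ℚ) = 1 := by exact_mod_cast padicValRat.self (p := 3) (by norm_num)
  rw [h3v] at hle'
  push_cast at hle'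
  linarith

/-! ### §2. Kraus's necessary condition at `3`: `9 ∣ c₆ ⟹ 27 ∣ c₆` on an integral model -/

/-- **Kraus at `3`, necessity**: for a Weierstrass model with INTEGER coefficients, `9 ∣ c₆` forces `27 ∣ c₆`
(`c₆ = −b₂³ + 36b₂b₄ − 216b₆`: `9 ∣ c₆` gives `3 ∣ b₂`, and then every term is divisible by `27`).  The trivial direction of
Kraus's criterion at `3`. [folklore] -/
theorem twentyseven_dvd_c₆_of_nine_dvd (Z : WeierstrassCurve ℤ) (h9 : (9 : ℤ) ∣ Z.c₆) : (27 : ℤ) ∣ Z.c₆ := by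
  have hc6 : Z.c₆ = -Z.b₂ ^ 3 + 36 * Z.b₂ * Z.b₄ - 216 * Z.b₆ := rfl
  have h3b : (3 : ℤ) ∣ Z.b₂ := by
    have h9' : (9 : ℤ) ∣ Z.b₂ ^ 3 := by
      have e : Z.b₂ ^ 3 = -Z.c₆ + 9 * (4 * Z.b₂ * Z.b₄ - 24 * Z.b₆) := by rw [hc6]; ring
      rw [e]
      exact dvd_add (dvd_neg.mpr h9) (dvd_mul_right 9 _)
    exact Int.prime_three.dvd_of_dvd_pow (dvd_trans ⟨3, by norm_num⟩ h9')
  obtain ⟨m, hm⟩ := h3b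
  rw [hc6, hm]
  exact ⟨-m ^ 3 + 4 * m * Z.b₄ - 8 * Z.b₆, by ring⟩

/-! ### §3. Ascent ⟹ congruence -/

/-- **THE CONVERSE OF (VÉLU₃♯): if the Vélu `3`-quotient by a rational `3`-torsion point ascends, the point satisfies the
`z⁹` congruence.**  `W/ℚ` globally minimal with `3`-integral `a₄♮, a₆♮`; `T = (X₁, Y₁)` of order `3` on `E♮`; `W'/ℚ`
globally minimal with `3⁴c₄(W') = 1440X₁² − 9c₄(W)` and `3⁶c₆(W') = 60480X₁³ − 756c₄(W)X₁ − 27c₆(W)`.  Then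
`‖(Y₁ − 4(α/3)³)/9‖₃ ≤ 1`.  [cite: SilvermanAEC2009, III.1 Table 3.1 and VII.1] -/
theorem congruence_of_isGloballyMinimal_three_velu_three (W : WeierstrassCurve ℚ) [W.IsElliptic] [W.IsGloballyMinimal]
    (hA : ‖(((shortModel W 1).a₄ : ℚ) : ℚ_[3])‖ ≤ 1) (hB : ‖(((shortModel W 1).a₆ : ℚ) : ℚ_[3])‖ ≤ 1)
    {X₁ Y₁ : ℚ} (hT : IsShortThreeTorsion W 1 X₁ Y₁) (W' : WeierstrassCurve ℚ) [W'.IsGloballyMinimal]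
    (h4 : (3 : ℚ) ^ 4 * W'.c₄ = 1440 * X₁ ^ 2 - 9 * W.c₄)
    (h6 : (3 : ℚ) ^ 6 * W'.c₆ = 60480 * X₁ ^ 3 - 756 * W.c₄ * X₁ - 27 * W.c₆) :
    ‖(((Y₁ - 4 * (tangentSlope W 1 X₁ Y₁ / 3) ^ 3) / 9 : ℚ) : ℚ_[3])‖ ≤ 1 := by
  have hY27 := one_lt_norm_div_twentyseven_of_isShortThreeTorsion W hA hB hT
  obtain ⟨hX, -⟩ := norm_le_one_of_isShortThreeTorsion W hA hB hT
  have hs := norm_tangentSlope_div_three_le_one hT hX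
  have hflex := tangentSlope_sq_eq_three_mul hT
  obtain ⟨hc4, hc6⟩ := c₄_c₆_eq_of_isShortThreeTorsion W hT
  set α := tangentSlope W 1 X₁ Y₁ with hαdef
  -- the integral model of `W'`
  set Z := integralModelInt W' with hZdef
  have hZ : Z.map (Int.castRingHom ℚ) = W' := map_integralModelInt W'
  have hZc6 : W'.c₆ = (Z.c₆ : ℚ) := by rw [← hZ, map_c₆]; simp
  have hZΔ : W'.Δ = (Z.Δ : ℚ) := by rw [← hZ, map_Δ]; simp
  -- the invariants of `W'` on the descaled model, `ν := (Y₁ − 4(α/3)³)/9`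
  set ν : ℚ := (Y₁ - 4 * (α / 3) ^ 3) / 9 with hνdef
  have hY₁ : Y₁ = 9 * ν + 4 * (α / 3) ^ 3 := by rw [hνdef]; ring
  rw [hc4] at h4
  rw [hc4, hc6] at h6
  have hc4' : W'.c₄ = 144 * (α / 3) ^ 4 + 288 * (α / 3) * ν := by
    rw [hνdef]
    linear_combination (h4 + (-16 * α ^ 2 - 48 * X₁) * hflex) / 81
  have hc6' : W'.c₆ = 1728 * (α / 3) ^ 6 + 5184 * (α / 3) ^ 3 * ν + 2592 * ν ^ 2 := by
    rw [hνdef]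
    linear_combination (h6 + (64 * α ^ 4 + 192 * X₁ * α ^ 2 + 576 * X₁ ^ 2 - 8640 * Y₁ * α) * hflex) / 729
  have hΔ' : W'.Δ = -432 * Y₁ * ν ^ 3 := by
    have h := W'.c_relation
    rw [hc4', hc6'] at h
    rw [hY₁]
    linear_combination h / 1728
  -- `3`-adic numerics
  haveI : Fact (Nat.Prime 3) := ⟨Nat.prime_three⟩
  set n : ℚ_[3] := ((ν : ℚ) : ℚ_[3]) with hndef
  set σ : ℚ_[3] := ((α / 3 : ℚ) : ℚ_[3]) with hσdef
  by_contra hν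
  rw [not_le] at hν
  have h3n : 3 ≤ ‖n‖ := three_le_norm_of_one_lt_norm_padicThree hν
  have hn16 : ‖(16 : ℚ_[3])‖ = 1 := by
    have := norm_natCast_padicThree_eq_one (n := 16) (by norm_num); simpa using this
  have hn32 : ‖(32 : ℚ_[3])‖ = 1 := by
    have := norm_natCast_padicThree_eq_one (n := 32) (by norm_num); simpa using this
  have hn64 : ‖(64 : ℚ_[3])‖ = 1 := by
    have := norm_natCast_padicThree_eq_one (n := 64) (by norm_num); simpa using this
  have h27 := norm_twentyseven_padicThree
  have h81 := norm_eightyone_padicThree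
  have hYn : 1 / 27 < ‖((Y₁ : ℚ) : ℚ_[3])‖ := by
    have e : ((Y₁ / 27 : ℚ) : ℚ_[3]) = ((Y₁ : ℚ) : ℚ_[3]) / 27 := by push_cast; ring
    rw [e, norm_div, h27, lt_div_iff₀ (by norm_num), one_mul] at hY27
    exact hY27
  by_cases h9 : 9 ≤ ‖n‖
  · -- `‖Δ(W')‖ > 1`, but `Δ(W') ∈ ℤ`
    have hΔn : ‖((W'.Δ : ℚ) : ℚ_[3])‖ ≤ 1 := by
      rw [hZΔ]; have := Padic.norm_int_le_one (p := 3) Z.Δ; exact_mod_cast this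
    have e : ((W'.Δ : ℚ) : ℚ_[3]) = -(432 : ℚ_[3]) * ((Y₁ : ℚ) : ℚ_[3]) * n ^ 3 := by
      rw [hΔ', hndef]; push_cast; ring
    have h432 : ‖(432 : ℚ_[3])‖ = 1 / 27 := by
      rw [show (432 : ℚ_[3]) = 16 * 27 by norm_num, norm_mul, hn16, h27, one_mul]
    rw [e, norm_mul, norm_mul, norm_neg, h432, norm_pow] at hΔn
    have hn3 : (729 : ℝ) ≤ ‖n‖ ^ 3 := by
      have h0 : (0 : ℝ) ≤ 9 := by norm_num
      nlinarith [mul_le_mul h9 h9 h0 (le_trans h0 h9), mul_le_mul (mul_le_mul h9 h9 h0 (le_trans h0 h9)) h9 h0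
        (mul_nonneg (le_trans h0 h9) (le_trans h0 h9))]
    have hA1 : ‖((Y₁ : ℚ) : ℚ_[3])‖ * 729 ≤ ‖((Y₁ : ℚ) : ℚ_[3])‖ * ‖n‖ ^ 3 :=
      mul_le_mul_of_nonneg_left hn3 (norm_nonneg _)
    have hA2 : (1 / 27 : ℝ) * 729 < ‖((Y₁ : ℚ) : ℚ_[3])‖ * 729 := mul_lt_mul_of_pos_right hYn (by norm_num)
    have hA3 : (1 / 27 : ℝ) * (‖((Y₁ : ℚ) : ℚ_[3])‖ * ‖n‖ ^ 3) ≤ 1 := by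
      calc (1 / 27 : ℝ) * (‖((Y₁ : ℚ) : ℚ_[3])‖ * ‖n‖ ^ 3) = 1 / 27 * ‖((Y₁ : ℚ) : ℚ_[3])‖ * ‖n‖ ^ 3 := by ring
        _ ≤ 1 := hΔn
    nlinarith [hA1, hA2, hA3]
  · -- `‖n‖ = 3`: `9 ∥ c₆(W')`, against Kraus
    rw [not_le] at h9
    have hn3 : ‖n‖ = 3 := le_antisymm (norm_le_three_of_norm_lt_nine_padicThree h9) h3n
    have hmain : ‖(2592 : ℚ_[3]) * n ^ 2‖ = 1 / 9 := by
      rw [show (2592 : ℚ_[3]) = 32 * 81 by norm_num, norm_mul, norm_mul, hn32, h81, norm_pow, hn3]; norm_num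
    have hrest : ‖(1728 : ℚ_[3]) * σ ^ 6 + 5184 * σ ^ 3 * n‖ ≤ 1 / 27 := by
      refine le_trans (Padic.nonarchimedean _ _) (max_le ?_ ?_)
      · rw [show (1728 : ℚ_[3]) = 64 * 27 by norm_num, norm_mul, norm_mul, hn64, h27, norm_pow, one_mul]
        exact mul_le_of_le_one_right (by norm_num) (pow_le_one₀ (norm_nonneg _) hs)
      · rw [show (5184 : ℚ_[3]) = 64 * 81 by norm_num, norm_mul, norm_mul, norm_mul, hn64, h81, norm_pow, hn3, one_mul]
        have : ‖σ‖ ^ 3 ≤ 1 := pow_le_one₀ (norm_nonneg _) hs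
        nlinarith [this, pow_nonneg (norm_nonneg σ) 3]
    have hc6n : ‖((W'.c₆ : ℚ) : ℚ_[3])‖ = 1 / 9 := by
      have e : ((W'.c₆ : ℚ) : ℚ_[3]) = ((1728 : ℚ_[3]) * σ ^ 6 + 5184 * σ ^ 3 * n) + 2592 * n ^ 2 := by
        rw [hc6', hndef, hσdef]; push_cast; ring
      have hne : ‖(1728 : ℚ_[3]) * σ ^ 6 + 5184 * σ ^ 3 * n‖ ≠ ‖(2592 : ℚ_[3]) * n ^ 2‖ := by
        rw [hmain]; exact ne_of_lt (lt_of_le_of_lt hrest (by norm_num))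
      rw [e, Padic.add_eq_max_of_ne hne, hmain, max_eq_right (le_trans hrest (by norm_num))]
    -- `9 ∣ c₆(Z)` and `27 ∤ c₆(Z)`
    have hZ9 : (9 : ℤ) ∣ Z.c₆ := by
      have h := (Padic.norm_int_le_pow_iff_dvd (p := 3) Z.c₆ 2).mp
      have e : ((W'.c₆ : ℚ) : ℚ_[3]) = ((Z.c₆ : ℤ) : ℚ_[3]) := by rw [hZc6]; push_cast; rfl
      rw [e] at hc6n
      exact_mod_cast h (by rw [hc6n]; norm_num)
    have hZ27 : ¬ (27 : ℤ) ∣ Z.c₆ := by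
      intro h27d
      have h := (Padic.norm_int_le_pow_iff_dvd (p := 3) Z.c₆ 3).mpr (by exact_mod_cast h27d)
      have e : ((W'.c₆ : ℚ) : ℚ_[3]) = ((Z.c₆ : ℤ) : ℚ_[3]) := by rw [hZc6]; push_cast; rfl
      rw [e] at hc6n
      rw [hc6n] at h
      norm_num at h
    exact hZ27 (twentyseven_dvd_c₆_of_nine_dvd Z hZ9)

/-! ### §4. The equivalence, and NB₃^V ⟺ NB₃^{cong} -/

/-- **ASCENT ⟺ CONGRUENCE** (globally minimal `W`, `3`-integral `E♮`, rational `3`-torsion `T = (X₁, Y₁)` on `E♮`): some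
globally minimal `W'` carries `(3⁻⁴A, 3⁻⁶B)` for `T`'s `u = 1` Vélu pair — the edge `W → W/⟨T⟩` ASCENDS — iff
`Y₁ ≡ 4(α/3)³ (mod 9)` in `ℤ₃`.  (⟸: p645684 `exists_isGloballyMinimal_three_velu_three_of_congruence`; ⟹: §3.)
[cite: DokchitserDokchitser2015LocalInvariants, §4 Lemma 10–11 and Table 1] -/
theorem exists_isGloballyMinimal_three_velu_three_iff_congruence (W : WeierstrassCurve ℚ) [W.IsElliptic]
    [W.IsGloballyMinimal] (hA : ‖(((shortModel W 1).a₄ : ℚ) : ℚ_[3])‖ ≤ 1)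
    (hB : ‖(((shortModel W 1).a₆ : ℚ) : ℚ_[3])‖ ≤ 1) {X₁ Y₁ : ℚ} (hT : IsShortThreeTorsion W 1 X₁ Y₁) :
    (∃ W' : WeierstrassCurve ℚ, W'.IsElliptic ∧ W'.IsGloballyMinimal ∧
        (3 : ℚ) ^ 4 * W'.c₄ = 1440 * X₁ ^ 2 - 9 * W.c₄ ∧
        (3 : ℚ) ^ 6 * W'.c₆ = 60480 * X₁ ^ 3 - 756 * W.c₄ * X₁ - 27 * W.c₆) ↔
      ‖(((Y₁ - 4 * (tangentSlope W 1 X₁ Y₁ / 3) ^ 3) / 9 : ℚ) : ℚ_[3])‖ ≤ 1 := by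
  constructor
  · rintro ⟨W', _, hW'm, h4, h6⟩
    haveI := hW'm
    exact congruence_of_isGloballyMinimal_three_velu_three W hA hB hT W' h4 h6
  · exact exists_isGloballyMinimal_three_velu_three_of_congruence W hA hB hT

/-- The same at a datum of level `9 ∣ N` (no integrality hypotheses). [cite: DokchitserDokchitser2015LocalInvariants, §4 Lemma 10–11 and Table 1] -/
theorem exists_isGloballyMinimal_three_velu_three_iff_congruence_of_nine_dvd (W : WeierstrassCurve ℚ) [W.IsElliptic]
    [W.IsGloballyMinimal] {N : ℕ} [NeZero N] (D : ModularParametrizationData W N) (h9 : 9 ∣ N) {X₁ Y₁ : ℚ}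
    (hT : IsShortThreeTorsion W 1 X₁ Y₁) :
    (∃ W' : WeierstrassCurve ℚ, W'.IsElliptic ∧ W'.IsGloballyMinimal ∧
        (3 : ℚ) ^ 4 * W'.c₄ = 1440 * X₁ ^ 2 - 9 * W.c₄ ∧
        (3 : ℚ) ^ 6 * W'.c₆ = 60480 * X₁ ^ 3 - 756 * W.c₄ * X₁ - 27 * W.c₆) ↔
      ‖(((Y₁ - 4 * (tangentSlope W 1 X₁ Y₁ / 3) ^ 3) / 9 : ℚ) : ℚ_[3])‖ ≤ 1 := by
  obtain ⟨hA, hB⟩ := norm_shortModel_le_one_of_nine_dvd W D h9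
  exact exists_isGloballyMinimal_three_velu_three_iff_congruence W hA hB hT

/-- **NB₃^V ⟺ NB₃^{cong}**: the stub `NoAscendingThreeTorsionOptimal` of line `kato_shift_three` (no optimal `W` at `9 ∣ N`
has a rational `3`-torsion point whose Vélu `3`-quotient ascends) is EQUIVALENT to the `W'`-free, elementary law «no optimal
`W` at `9 ∣ N` has a rational `3`-torsion point `T = (X₁, Y₁)` on `E♮` with `Y₁ ≡ 4(α/3)³ (mod 9)`», i.e. every such point
has `‖(Y₁ − 4(α/3)³)/9‖₃ > 1`. [folklore] -/
theorem noAscendingThreeTorsionOptimal_iff_noCongruentThreeTorsionOptimal :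
    NoAscendingThreeTorsionOptimal ↔
      ∀ (W : WeierstrassCurve ℚ) [W.IsElliptic] [W.IsGloballyMinimal] {N : ℕ} [NeZero N]
        (D : ModularParametrizationData W N),
        (∀ z ∈ D.L.lattice, ∃ w ∈ periodLattice D.f, z = D.c * w) → 9 ∣ N →
        ∀ X₁ Y₁ : ℚ, IsShortThreeTorsion W 1 X₁ Y₁ →
        1 < ‖(((Y₁ - 4 * (tangentSlope W 1 X₁ Y₁ / 3) ^ 3) / 9 : ℚ) : ℚ_[3])‖ := by
  constructor
  · intro h W _ _ N _ D hL h9 X₁ Y₁ hT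
    rw [← not_le, ← exists_isGloballyMinimal_three_velu_three_iff_congruence_of_nine_dvd W D h9 hT]
    exact h W D hL h9 X₁ Y₁ hT
  · intro h W _ _ N _ D hL h9 X₁ Y₁ hT hex
    have h1 := h W D hL h9 X₁ Y₁ hT
    rw [← not_le] at h1
    exact h1 ((exists_isGloballyMinimal_three_velu_three_iff_congruence_of_nine_dvd W D h9 hT).mp hex)

end Summit.BirchSwinnertonDyer.BirchSwinnertonDyer.Theorems.ManinLocalTwoThree

end
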